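import Mathlib.GroupTheory.Perm.Basic
import Mathlib.Data.Finite.Sum
import Literature.GroupTheory.CombinatorialGroupTheory.FreeGroupoidFiniteRank
import HarnessLib

/-!
# The rank of the vertex groups of a finite free groupoid: `#loops + #objects = #arrows + 1`, and
# non-abelianness when `#arrows ≥ #objects + 1`

Topic `Literature/GroupTheory/CombinatorialGroupTheory`; PROOF-ONLY (no definitions).  Classical
bookkeeping (R. C. Lyndon, P. E. Schupp, *Combinatorial Group Theory*, Ch. I Prop. 3.7–3.9: the
Schreier / spanning-tree basis; J.-P. Serre, *Trees*, I §3: the fundamental group of a finite connected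
graph is free of rank `|E| - |V| + 1`).  `SchreierIndexFormula.lean` does this count for the coset
groupoid of a subgroup of a free group; here the SAME count (proofs follow that file) for ANY
arborescence of the symmetrised generating quiver of a free groupoid `Y` with finitely many objects and
generating arrows (e.g. the geodesic one rooted at an object `r` from which every object is reachable):

* `FreeGroupoidRank.card_treeArrows_add_one` — the tree has `#objects - 1` arrows;
* `FreeGroupoidRank.card_loopIndex_add_card` — `#(LoopIndex T) + #Y = #(Total (Generators Y)) + 1`;
* `FreeGroupBasis.apply_mul_apply_ne` — two distinct elements of a free basis do not commute;
* `IsFreeGroupoid.exists_not_commute_end` / `…_vertexGroup` — if `#Y + 1 ≤ #arrows`, the vertex group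
  at `r` contains two non-commuting elements (two basis loops);
* `SemiGraph.exists_not_commute_fundamentalGroup` — for a semi-graph with finitely many vertices,
  edges and branches, reachability from `c`, and `#vertices + #edges + 1 ≤ #(abutting branches)`
  (cyclomatic number `≥ 2`), `π₁(𝔾, c)` contains two non-commuting elements.

Intended consumer (abc-iut cell): the residual hypothesis "one Galois level with non-abelian graph
fundamental group" of `TemperedPiTowerOfGaloisSeq.lean` becomes a COUNT of orbits.  No new mathematics;
nothing here takes a side on any disputed claim.
-/

namespace Literature.GroupTheory.CombinatorialGroupTheory

open CategoryTheory Quiver _root_.IsFreeGroupoid FreeGroupoidTree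

universe u

noncomputable section

/-! ### Distinct free generators do not commute -/

/-- **Two distinct elements of a free basis do not commute** (their images `(0 1)`, `(1 2)` under a
suitable homomorphism to `S_3` do not). [cite: LyndonSchupp2001, Ch. I Prop. 3.7] -/
theorem FreeGroupBasis.apply_mul_apply_ne {ι G : Type*} [Group G] (b : FreeGroupBasis ι G) {i j : ι}
    (hij : i ≠ j) : b i * b j ≠ b j * b i := by
  classical
  -- a homomorphism `G → S_3` with `b i ↦ (0 1)`, `b j ↦ (1 2)`
  let f : ι → Equiv.Perm (Fin 3) := fun k =>
    if k = i then Equiv.swap 0 1 else if k = j then Equiv.swap 1 2 else 1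
  let φ : G →* Equiv.Perm (Fin 3) := b.lift f
  have hi : φ (b i) = Equiv.swap 0 1 := by
    change b.lift f (b i) = _
    rw [FreeGroupBasis.lift_apply_apply]; simp [f]
  have hj : φ (b j) = Equiv.swap 1 2 := by
    change b.lift f (b j) = _
    rw [FreeGroupBasis.lift_apply_apply]; simp [f, hij.symm]
  intro h
  have h' := congrArg φ h
  rw [map_mul, map_mul, hi, hj] at h'
  exact absurd (Equiv.congr_fun h' 0) (by decide)

/-! ### Counting tree arrows and loops of an arborescence of a free groupoid -/

namespace FreeGroupoidRank

/- As in Mathlib's `NielsenSchreier.lean` and the tree's `FreeGroupoidTreeBasis.lean` /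
`SchreierIndexFormula.lean`: type synonyms for the objects of the groupoid must be unfolded by unification. -/
set_option backward.isDefEq.respectTransparency false

variable {Y : Type u} [Groupoid.{u} Y] [IsFreeGroupoid Y]
  (T : WideSubquiver (Symmetrify (Generators Y))) [Arborescence T]

/-- In an arborescence the tree path to `b` is the unique one. [cite: LyndonSchupp2001, Ch. I Prop. 3.9] -/
theorem path_eq_default {b : T} (p : Path (root T) b) : p = default := Subsingleton.elim _ _

/-- A symmetrised arrow lying in the tree enters a vertex other than the root.
[cite: LyndonSchupp2001, Ch. I Prop. 3.9] -/
theorem ne_root_of_mem_tree {a b : Symmetrify (Generators Y)} (f : a ⟶ b) (hf : f ∈ T a b) :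
    b ≠ rootVtx T := by
  rintro rfl
  have h := path_eq_default T
    ((default : Path (root T) (show T from a)).cons (⟨f, hf⟩ : (show T from a) ⟶ root T))
  have h0 := path_eq_default T (Path.nil : Path (root T) (root T))
  rw [← h0] at h
  exact Path.nil_ne_cons _ _ h.symm

/-- Two tree arrows with the same target coincide (source and arrow).
[cite: LyndonSchupp2001, Ch. I Prop. 3.9] -/
theorem tree_target_unique {a a' b : Symmetrify (Generators Y)} {f : a ⟶ b} {f' : a' ⟶ b}
    (hf : f ∈ T a b) (hf' : f' ∈ T a' b) : a = a' ∧ HEq f f' := by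
  have h := (path_eq_default T ((default : Path (root T) (show T from a)).cons
      (⟨f, hf⟩ : (show T from a) ⟶ (show T from b)))).trans
    (path_eq_default T ((default : Path (root T) (show T from a')).cons
      (⟨f', hf'⟩ : (show T from a') ⟶ (show T from b)))).symm
  have h1 := Path.obj_eq_of_cons_eq_cons h
  subst h1
  have h2 := Path.hom_heq_of_cons_eq_cons h
  refine ⟨rfl, ?_⟩
  have h3 : (⟨f, hf⟩ : (show T from a) ⟶ (show T from b)) = ⟨f', hf'⟩ := eq_of_heq h2
  cases h3
  rfl

/-- An arrow of the tree forbids its reversal in the tree (the two tree paths would each be longer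
than the other). [cite: LyndonSchupp2001, Ch. I Prop. 3.9] -/
theorem not_mem_tree_of_mem_tree {a b : Symmetrify (Generators Y)} {f : a ⟶ b} (hf : f ∈ T a b)
    (f' : b ⟶ a) : f' ∉ T b a := by
  intro hf'
  have h1 := congrArg Path.length (path_eq_default T ((default : Path (root T) (show T from a)).cons
    (⟨f, hf⟩ : (show T from a) ⟶ (show T from b))))
  have h2 := congrArg Path.length (path_eq_default T ((default : Path (root T) (show T from b)).cons
    (⟨f', hf'⟩ : (show T from b) ⟶ (show T from a))))
  rw [Path.length_cons] at h1 h2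
  omega

/-- **The tree has `#objects - 1` arrows**: "the vertex a tree arrow enters" is a bijection from the
tree arrows (generating arrows used in either orientation) onto the non-root objects.
[cite: LyndonSchupp2001, Ch. I Prop. 3.9] -/
theorem card_treeArrows_add_one [Finite Y] [Finite (Total (Generators Y))] :
    Nat.card (treeArrows T) + 1 = Nat.card Y := by
  classical
  -- the vertex at which a tree arrow enters: its target if used forwards, its source if backwards
  let tgt : treeArrows T → Y := fun E =>
    if Sum.inl E.1.hom ∈ T E.1.left E.1.right then E.1.right else E.1.left
  have htgt_ne : ∀ E, tgt E ≠ rootObj T := by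
    rintro ⟨⟨a, b, e⟩, hE⟩
    dsimp only [tgt]
    split_ifs with h
    · exact ne_root_of_mem_tree T _ h
    · rcases hE with h' | h'
      · exact absurd h' h
      · exact ne_root_of_mem_tree T _ h'
  have htgt_inj : Function.Injective tgt := by
    rintro ⟨⟨a, b, e⟩, hE⟩ ⟨⟨a', b', e'⟩, hE'⟩ h
    dsimp only [tgt] at h
    by_cases h1 : Sum.inl e ∈ T a b <;> by_cases h2 : Sum.inl e' ∈ T a' b'
    · rw [if_pos h1, if_pos h2] at h
      subst h
      obtain ⟨rfl, hh⟩ := tree_target_unique T h1 h2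
      cases hh
      rfl
    · rw [if_pos h1, if_neg h2] at h
      subst h
      rcases hE' with h' | h'
      · exact absurd h' h2
      · obtain ⟨rfl, hh⟩ := tree_target_unique T h1 h'
        cases hh
    · rw [if_neg h1, if_pos h2] at h
      subst h
      rcases hE with h' | h'
      · exact absurd h' h1
      · obtain ⟨rfl, hh⟩ := tree_target_unique T h' h2
        cases hh
    · rw [if_neg h1, if_neg h2] at h
      subst h
      rcases hE with h' | h'
      · exact absurd h' h1
      rcases hE' with h'' | h''
      · exact absurd h'' h2
      obtain ⟨rfl, hh⟩ := tree_target_unique T h' h''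
      cases hh
      rfl
  have htgt_surj : ∀ b : Y, b ≠ rootObj T → ∃ E, tgt E = b := by
    intro b hb
    rcases hp : (default : Path (root T) (show T from b)) with _ | ⟨p, f⟩
    · exact absurd rfl hb
    · obtain ⟨f, hf⟩ := f
      rcases f with e | e
      · refine ⟨⟨⟨_, _, e⟩, Or.inl hf⟩, ?_⟩
        dsimp only [tgt]
        rw [if_pos hf]
      · refine ⟨⟨⟨_, _, e⟩, Or.inr hf⟩, ?_⟩
        dsimp only [tgt]
        rw [if_neg (not_mem_tree_of_mem_tree T hf _)]
  have h1 : Nat.card (treeArrows T) = Nat.card {b : Y // ¬ b = rootObj T} :=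
    Nat.card_eq_of_bijective (fun E => ⟨tgt E, htgt_ne E⟩)
      ⟨fun E E' h => htgt_inj (congrArg Subtype.val h),
        fun b => by
          obtain ⟨E, hE⟩ := htgt_surj b.1 b.2
          exact ⟨E, Subtype.ext hE⟩⟩
  have h2 : Nat.card {b : Y // b = rootObj T} = 1 := by rw [Nat.card_unique]
  have h3 : Nat.card {b : Y // b = rootObj T} + Nat.card {b : Y // ¬ b = rootObj T} = Nat.card Y := by
    rw [← Nat.card_sum, Nat.card_congr (Equiv.sumCompl fun b : Y => b = rootObj T)]
  omega

/-- **`#(LoopIndex T) + #objects = #(generating arrows) + 1`**: the rank of the vertex group at the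
root (spanning-tree basis `treeBasis T`) is the cyclomatic number. [cite: LyndonSchupp2001, Ch. I Prop. 3.9] -/
theorem card_loopIndex_add_card [Finite Y] [Finite (Total (Generators Y))] :
    Nat.card (LoopIndex T) + Nat.card Y = Nat.card (Total (Generators Y)) + 1 := by
  have h1 : (treeArrows T).ncard + (treeArrows T)ᶜ.ncard = Nat.card (Total (Generators Y)) :=
    Set.ncard_add_ncard_compl _
  have h2 := card_treeArrows_add_one T
  rw [Nat.card_coe_set_eq] at h2
  have h3 : Nat.card (LoopIndex T) = (treeArrows T)ᶜ.ncard := Nat.card_coe_set_eq _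
  omega

/-- **Two non-commuting loops at the root** when the cyclomatic number is `≥ 2`
(`#objects + 1 ≤ #arrows`): two distinct spanning-tree basis elements.
[cite: LyndonSchupp2001, Ch. I Prop. 3.7] -/
theorem exists_not_commute_end_rootObj [Finite Y] [Finite (Total (Generators Y))]
    (hcard : Nat.card Y + 1 ≤ Nat.card (Total (Generators Y))) :
    ∃ a b : End (rootObj T), a * b ≠ b * a := by
  haveI : Finite (LoopIndex T) := finite_loopIndex T
  have h2 : 2 ≤ Nat.card (LoopIndex T) := by
    have := card_loopIndex_add_card T
    omega
  have h1 : 1 < Nat.card (LoopIndex T) := h2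
  rw [Finite.one_lt_card_iff_nontrivial] at h1
  obtain ⟨i, j, hij⟩ := h1
  exact ⟨treeBasis T i, treeBasis T j, FreeGroupBasis.apply_mul_apply_ne _ hij⟩

end FreeGroupoidRank

/-! ### The criterion at an arbitrary root -/

section Criterion

variable {Y : Type u} [Groupoid.{u} Y] [IsFreeGroupoid Y]

/-- **Non-abelian vertex groups from the cyclomatic number**: if every object of the free groupoid `Y`
is reachable from `r` and `#Y + 1 ≤ #(generating arrows)`, then `End r` contains two non-commuting
elements. [cite: LyndonSchupp2001, Ch. I Prop. 3.7] -/
theorem IsFreeGroupoid.exists_not_commute_end (r : Y) (h : ∀ a : Y, Nonempty (r ⟶ a)) [Finite Y]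
    [Finite (Total (Generators Y))] (hcard : Nat.card Y + 1 ≤ Nat.card (Total (Generators Y))) :
    ∃ a b : End r, a * b ≠ b * a := by
  haveI := IsFreeGroupoid.rootedConnected_of_nonempty_hom r h
  exact FreeGroupoidRank.exists_not_commute_end_rootObj
    (Quiver.geodesicSubtree (show Symmetrify (Generators Y) from r)) hcard

/-- The same for the VERTEX GROUP `r ⟶ r` (anti-isomorphic to `End r` through the identity map, so
non-commuting pairs correspond). [cite: LyndonSchupp2001, Ch. I Prop. 3.7] -/
theorem IsFreeGroupoid.exists_not_commute_vertexGroup (r : Y) (h : ∀ a : Y, Nonempty (r ⟶ a))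
    [Finite Y] [Finite (Total (Generators Y))]
    (hcard : Nat.card Y + 1 ≤ Nat.card (Total (Generators Y))) :
    ∃ a b : (r ⟶ r), a * b ≠ b * a := by
  obtain ⟨a, b, hab⟩ := IsFreeGroupoid.exists_not_commute_end r h hcard
  refine ⟨(show (r ⟶ r) from a), (show (r ⟶ r) from b), fun h' => hab ?_⟩
  -- `End r` multiplication is the opposite of the vertex-group multiplication
  change b ≫ a = a ≫ b
  exact h'.symm

end Criterion

/-! ### The fundamental group of a finite semi-graph -/

section SemiGraph

open Literature.AnabelianGeometry.SemiGraphs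

variable (G : Literature.AnabelianGeometry.SemiGraphs.SemiGraph.{u})

/-- The generating arrows of the fundamental groupoid of a semi-graph are in bijection with its
ABUTTING branches. [cite: MochizukiSemiAnbd2006, Def. 2.11 p.32] -/
theorem SemiGraph.card_total_generators_fundamentalGroupoid [Finite G.Branch] :
    Nat.card (Quiver.Total (Generators G.FundamentalGroupoid)) =
      Nat.card {b : G.Branch // (G.abuts b).isSome} := by
  classical
  refine Nat.card_congr ?_
  refine Equiv.ofBijective (fun t => match t with
    | ⟨⟨Sum.inr _⟩, ⟨Sum.inl _⟩, ⟨b⟩⟩ => ⟨b.1, by rw [b.2.2]; rfl⟩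
    | ⟨⟨Sum.inl _⟩, ⟨Sum.inl _⟩, ⟨b⟩⟩ => PEmpty.elim b
    | ⟨⟨Sum.inl _⟩, ⟨Sum.inr _⟩, ⟨b⟩⟩ => PEmpty.elim b
    | ⟨⟨Sum.inr _⟩, ⟨Sum.inr _⟩, ⟨b⟩⟩ => PEmpty.elim b) ⟨?_, ?_⟩
  · rintro ⟨⟨a⟩, ⟨a'⟩, ⟨b⟩⟩ ⟨⟨c⟩, ⟨c'⟩, ⟨d⟩⟩ hbd
    rcases a with v | e <;> rcases a' with v' | e' <;> try exact PEmpty.elim b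
    rcases c with w | g <;> rcases c' with w' | g' <;> try exact PEmpty.elim d
    rcases b with ⟨b, hbe, hbv⟩
    rcases d with ⟨d, hde, hdv⟩
    have hbd' : b = d := congrArg Subtype.val hbd
    subst hbd'
    obtain rfl : e = g := hbe.symm.trans hde
    obtain rfl : v' = w' := Option.some_injective _ (hbv.symm.trans hdv)
    rfl
  · rintro ⟨b, hb⟩
    obtain ⟨v, hv⟩ := Option.isSome_iff_exists.mp hb
    exact ⟨⟨⟨Sum.inr (G.edgeOf b)⟩, ⟨Sum.inl v⟩, ⟨⟨b, rfl, hv⟩⟩⟩, rfl⟩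

/-- The objects of the fundamental groupoid are the components (vertices and edges).
[cite: MochizukiSemiAnbd2006, Def. 2.11 p.32] -/
theorem SemiGraph.card_fundamentalGroupoid [Finite G.Vertex] [Finite G.Edge] :
    Nat.card G.FundamentalGroupoid = Nat.card G.Vertex + Nat.card G.Edge := by
  rw [← Nat.card_sum]
  exact Nat.card_congr ⟨fun a => a.as, fun c => ⟨c⟩, fun _ => rfl, fun _ => rfl⟩

/-- **The fundamental group of a finite semi-graph with cyclomatic number `≥ 2` is non-abelian**: if
`𝔾` has finitely many vertices, edges and branches, every component is reachable from `c` in the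
fundamental groupoid, and `#vertices + #edges + 1 ≤ #(abutting branches)`, then `π₁(𝔾, c)` contains two
non-commuting elements (two independent basis loops of the spanning-tree basis; Serre, *Trees*, I §3:
rank `= |E| - |V| + 1` for a graph). [cite: MochizukiSemiAnbd2006, §1 p.20] -/
theorem SemiGraph.exists_not_commute_fundamentalGroup [Finite G.Vertex] [Finite G.Edge]
    [Finite G.Branch] (c : G.CatCarrier) (hc : ∀ a : G.CatCarrier, Nonempty (G.basept c ⟶ G.basept a))
    (hcard : Nat.card G.Vertex + Nat.card G.Edge + 1 ≤ Nat.card {b : G.Branch // (G.abuts b).isSome}) :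
    ∃ a b : G.FundamentalGroup c, a * b ≠ b * a := by
  haveI := SemiGraph.finite_total_generators_fundamentalGroupoid G
  haveI : Finite (G.Vertex ⊕ G.Edge) := inferInstance
  haveI : Finite G.FundamentalGroupoid :=
    Finite.of_equiv (G.Vertex ⊕ G.Edge) ⟨fun x => ⟨x⟩, fun a => a.as, fun _ => rfl, fun _ => rfl⟩
  have h : ∀ a : G.FundamentalGroupoid, Nonempty (G.basept c ⟶ a) := fun a => hc a.as
  refine IsFreeGroupoid.exists_not_commute_vertexGroup (G.basept c) h ?_
  rw [SemiGraph.card_fundamentalGroupoid, SemiGraph.card_total_generators_fundamentalGroupoid]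
  exact hcard

end SemiGraph

end

end Literature.GroupTheory.CombinatorialGroupTheory
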